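import Mathlib
import HarnessLib

/-!
# ValiantsHypothesis / LacunarySymmetroid — crux `MatrixDescartes` (stmt-ValiantsHypothesis-18050, V1),
# line «osculation-law»: symmetric letters are REAL-ROOTED (every rank, every degeneracy)

For a real symmetric matrix `G` on `Fin r ⊕ Fin s` and the block projector `P = I_r ⊕ 0`, the real polynomial
`b ↦ det(G + b·P)` SPLITS over `ℝ` — all its complex roots are real — with no assumption on `det G₂₂`
(`splits_det_add_X_smul_blockProj`).  Proof: a complex root `z` gives a kernel vector `v ≠ 0` of `G + zP`; then
`v* G v + z · v* P v = 0` with `v* G v ∈ ℝ` (Hermitian) and `v* P v = Σ_{inl} |v_i|² ≥ 0`; if `v* P v ≠ 0` the root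
is real, otherwise `P v = 0`, hence `G v = 0` and `G + wP` is singular for EVERY `w`, i.e. the polynomial vanishes
identically (and the zero polynomial splits).  A real polynomial all of whose complex roots are real splits
(`splits_of_complex_roots_real`, induction on the degree).  Consequences in value form for the degenerate branches of
the osculation-law columns (a splitting quadratic with nonzero leading coefficient has nonnegative discriminant,
`discrim_nonneg_of_splits`).  Honest framing: linear-algebra bookkeeping; nothing here bears on `OsculationLaw`,
`MatrixDescartes`, Conjecture B or `VP ≠ VNP`.  No definitions, no named facts; Mathlib only.
-/

-- `Summit.ValiantsHypothesis.ValiantsHypothesis.…` is the tree's mandated single-conjunct layout (Sub = Summit).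
set_option linter.dupNamespace false

noncomputable section

namespace Summit.ValiantsHypothesis.ValiantsHypothesis.Theorems.LacunarySymmetroidMatrixDescartes

namespace OsculationLetter

open Polynomial
open scoped BigOperators ComplexConjugate Matrix

/-! ### A real polynomial with only real complex roots splits -/

/-- If every complex root of the real polynomial `f ≠ 0` is real then `f` splits over `ℝ`. [folklore] -/
theorem splits_of_complex_roots_real (f : ℝ[X]) (hf : f ≠ 0)
    (h : ∀ z : ℂ, (f.map (algebraMap ℝ ℂ)).IsRoot z → z.im = 0) : f.Splits := by
  induction hn : f.natDegree using Nat.strong_induction_on generalizing f with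
  | _ n ih =>
    by_cases hdeg : f.natDegree = 0
    · exact Splits.of_natDegree_eq_zero hdeg
    have hdegC : (f.map (algebraMap ℝ ℂ)).degree ≠ 0 := by
      rw [degree_map]
      exact fun h' => hdeg (natDegree_eq_of_degree_eq_some h')
    obtain ⟨z, hz⟩ := IsAlgClosed.exists_root _ hdegC
    have hzre : ((z.re : ℝ) : ℂ) = z := Complex.ext rfl (by simp [h z hz])
    have hx : f.IsRoot z.re := by
      have h1 : (f.map (algebraMap ℝ ℂ)).eval ((algebraMap ℝ ℂ) z.re) = 0 := by
        rw [show (algebraMap ℝ ℂ) z.re = z from hzre]; exact hz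
      rw [eval_map, eval₂_hom] at h1
      exact (algebraMap ℝ ℂ).injective h1
    have hmul : (X - C z.re) * (f /ₘ (X - C z.re)) = f := mul_divByMonic_eq_iff_isRoot.2 hx
    have hg0 : f /ₘ (X - C z.re) ≠ 0 := by
      intro h0; rw [h0, mul_zero] at hmul; exact hf hmul.symm
    have hgdeg : (f /ₘ (X - C z.re)).natDegree < n := by
      rw [natDegree_divByMonic f (monic_X_sub_C z.re), natDegree_X_sub_C]
      omega
    have hgroots : ∀ w : ℂ, ((f /ₘ (X - C z.re)).map (algebraMap ℝ ℂ)).IsRoot w → w.im = 0 := by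
      intro w hw
      apply h
      rw [← hmul, Polynomial.map_mul, IsRoot, eval_mul, hw.eq_zero, mul_zero]
    rw [← hmul]
    exact (Splits.X_sub_C _).mul (ih _ hgdeg _ hg0 hgroots rfl)

/-- A splitting real quadratic `a X² + m X + d` with `a ≠ 0` has nonnegative discriminant. [folklore] -/
theorem discrim_nonneg_of_splits (a m d : ℝ) (ha : a ≠ 0) (hs : (C a * X ^ 2 + C m * X + C d).Splits) :
    4 * (a * d) ≤ m ^ 2 := by
  have hdeg : (C a * X ^ 2 + C m * X + C d).degree ≠ 0 := by
    rw [degree_quadratic ha]; decide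
  obtain ⟨x, hx⟩ := hs.exists_eval_eq_zero hdeg
  simp only [eval_add, eval_mul, eval_C, eval_pow, eval_X] at hx
  have hd := discrim_eq_sq_of_quadratic_eq_zero (a := a) (b := m) (c := d) (x := x) (by rw [← hx]; ring)
  rw [discrim] at hd
  nlinarith [sq_nonneg (2 * a * x + m)]

/-! ### Symmetric letters are real-rooted -/

/-- Evaluating the letter polynomial `det(C(G) + X·C(P))` at a complex number through `ℝ → ℂ`. [folklore] -/
theorem eval₂_det_letter {ι : Type*} [Fintype ι] [DecidableEq ι] (G P : Matrix ι ι ℝ) (w : ℂ) :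
    (Matrix.det (G.map Polynomial.C + (X : ℝ[X]) • P.map Polynomial.C)).eval₂ (algebraMap ℝ ℂ) w =
      Matrix.det (G.map (algebraMap ℝ ℂ) + w • P.map (algebraMap ℝ ℂ)) := by
  rw [← Polynomial.coe_eval₂RingHom, RingHom.map_det, RingHom.mapMatrix_apply]
  congr 1
  ext i j
  simp only [Matrix.map_apply, Matrix.add_apply, Matrix.smul_apply, smul_eq_mul, Polynomial.coe_eval₂RingHom,
    eval₂_add, eval₂_mul, eval₂_C, eval₂_X]

/-- **Symmetric letters split over `ℝ`.**  For a real symmetric `G` on `Fin r ⊕ Fin s`, the real polynomial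
`det(C(G) + X·C(I_r ⊕ 0))` splits (every complex root is real, or the polynomial is zero). [folklore] -/
theorem splits_det_add_X_smul_blockProj (r s : ℕ) (G : Matrix (Fin r ⊕ Fin s) (Fin r ⊕ Fin s) ℝ)
    (hG : G.IsSymm) :
    (Matrix.det (G.map Polynomial.C
      + (X : ℝ[X]) • (Matrix.fromBlocks 1 0 0 0 : Matrix (Fin r ⊕ Fin s) (Fin r ⊕ Fin s) ℝ).map Polynomial.C)).Splits := by
  classical
  set P : Matrix (Fin r ⊕ Fin s) (Fin r ⊕ Fin s) ℝ := Matrix.fromBlocks 1 0 0 0 with hP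
  set f : ℝ[X] := Matrix.det (G.map Polynomial.C + (X : ℝ[X]) • P.map Polynomial.C) with hf
  rcases eq_or_ne f 0 with h0 | h0
  · rw [h0]; exact Splits.zero
  refine splits_of_complex_roots_real f h0 fun z hz => ?_
  -- a complex kernel vector
  set Gc : Matrix (Fin r ⊕ Fin s) (Fin r ⊕ Fin s) ℂ := G.map (algebraMap ℝ ℂ) with hGc
  set Pc : Matrix (Fin r ⊕ Fin s) (Fin r ⊕ Fin s) ℂ := P.map (algebraMap ℝ ℂ) with hPc
  have hdet : ∀ w : ℂ, (f.map (algebraMap ℝ ℂ)).eval w = (Gc + w • Pc).det := by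
    intro w; rw [eval_map, hf, eval₂_det_letter]
  have hz' : (Gc + z • Pc).det = 0 := by rw [← hdet]; exact hz
  obtain ⟨v, hv0, hv⟩ := Matrix.exists_mulVec_eq_zero_iff.2 hz'
  -- the two quadratic forms
  have hGherm : Gc.IsHermitian := by
    refine Matrix.IsHermitian.ext fun i j => ?_
    rw [hGc, Matrix.map_apply, Matrix.map_apply, hG.apply i j, Complex.coe_algebraMap, Complex.star_def,
      Complex.conj_ofReal]
  have hα : (star v ⬝ᵥ Gc *ᵥ v).im = 0 := by
    have := hGherm.im_star_dotProduct_mulVec_self v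
    simpa using this
  have hPv : Pc *ᵥ v = Sum.elim (v ∘ Sum.inl) 0 := by
    have hPc' : Pc = Matrix.fromBlocks 1 0 0 0 := by
      rw [hPc, hP, Matrix.fromBlocks_map, Matrix.map_one _ (map_zero _) (map_one _),
        Matrix.map_zero _ (map_zero _), Matrix.map_zero _ (map_zero _), Matrix.map_zero _ (map_zero _)]
    rw [hPc', Matrix.fromBlocks_mulVec]
    simp
  have hβ : star v ⬝ᵥ Pc *ᵥ v = ((∑ i : Fin r, Complex.normSq (v (Sum.inl i)) : ℝ) : ℂ) := by
    rw [hPv, dotProduct, Fintype.sum_sum_type]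
    simp only [Pi.star_apply, Sum.elim_inl, Sum.elim_inr, Function.comp_apply, Pi.zero_apply, mul_zero,
      Finset.sum_const_zero, add_zero, Complex.ofReal_sum, Complex.normSq_eq_conj_mul_self, Complex.star_def]
  -- the identity `v*Gv + z · v*Pv = 0`
  have hsum : star v ⬝ᵥ Gc *ᵥ v + z * (star v ⬝ᵥ Pc *ᵥ v) = 0 := by
    have := congrArg (fun u => star v ⬝ᵥ u) hv
    simpa [Matrix.add_mulVec, Matrix.smul_mulVec, dotProduct_add, dotProduct_smul] using this
  by_contra hzim
  -- then `v* P v = 0`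
  have hβ0 : ∑ i : Fin r, Complex.normSq (v (Sum.inl i)) = 0 := by
    have him := congrArg Complex.im hsum
    rw [Complex.add_im, hα, hβ, Complex.mul_im, Complex.ofReal_re, Complex.ofReal_im, mul_zero, zero_add,
      zero_add, Complex.zero_im] at him
    rcases mul_eq_zero.1 him with h | h
    · exact absurd h hzim
    · exact h
  have hvinl : ∀ i : Fin r, v (Sum.inl i) = 0 := by
    intro i
    have := (Finset.sum_eq_zero_iff_of_nonneg fun j _ => Complex.normSq_nonneg (v (Sum.inl j))).1 hβ0 i
      (Finset.mem_univ _)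
    exact Complex.normSq_eq_zero.1 this
  have hPv0 : Pc *ᵥ v = 0 := by
    rw [hPv]; funext x; rcases x with i | j
    · simp [hvinl i]
    · simp
  have hGv0 : Gc *ᵥ v = 0 := by
    have := hv
    rwa [Matrix.add_mulVec, Matrix.smul_mulVec, hPv0, smul_zero, add_zero] at this
  -- so every `w` is a root: the polynomial is zero
  apply h0
  have hall : ∀ w : ℂ, (f.map (algebraMap ℝ ℂ)).IsRoot w := by
    intro w
    rw [IsRoot, hdet]
    exact Matrix.exists_mulVec_eq_zero_iff.1
      ⟨v, hv0, by rw [Matrix.add_mulVec, Matrix.smul_mulVec, hPv0, smul_zero, add_zero, hGv0]⟩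
  have hmap0 : f.map (algebraMap ℝ ℂ) = 0 :=
    Polynomial.eq_zero_of_infinite_isRoot _ (Set.infinite_univ.mono fun w _ => hall w)
  exact (Polynomial.map_injective _ (algebraMap ℝ ℂ).injective) (by rw [hmap0, Polynomial.map_zero])

/-- The same letter polynomial evaluated at a real `b` is `det(G + b·P)`. [folklore] -/
theorem eval_det_letter {ι : Type*} [Fintype ι] [DecidableEq ι] (G P : Matrix ι ι ℝ) (b : ℝ) :
    (Matrix.det (G.map Polynomial.C + (X : ℝ[X]) • P.map Polynomial.C)).eval b = Matrix.det (G + b • P) := by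
  rw [← Polynomial.coe_evalRingHom, RingHom.map_det, RingHom.mapMatrix_apply]
  congr 1
  ext i j
  simp only [Matrix.map_apply, Matrix.add_apply, Matrix.smul_apply, smul_eq_mul, Polynomial.coe_evalRingHom,
    eval_add, eval_mul, eval_C, eval_X]

end OsculationLetter

end Summit.ValiantsHypothesis.ValiantsHypothesis.Theorems.LacunarySymmetroidMatrixDescartes
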